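import Summits.QuantumFields.YangMills.Theorems.FluctuationComparisonRegPrIntLS2BetaComposedDilutionKernelSourceFamily
import Summits.QuantumFields.YangMills.Theorems.FluctuationComparisonRegPrIntLS2BetaSourceDock
import HarnessLib

/-!
# S2β · (S-SRC-5) THE SOURCE BUDGET CORE — the (K5′)-edition of the curl-kernel knit: the weighted read-cell maxima of ANY nonnegative family obeying the lower-left rows with
# sources are bounded by the DOCKED finest data energy plus the DOCKED source energies, level by level, with geometric weights over the source levels — no row sum, no sup,
# no `log N` (HAZARD «SRC-q» cured in the ARCHITECT's shape of record, RULING 19:27:44Z)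

Cell `ym3-torus` (YM ladder rung R3 = continuum `SU(2)` Yang–Mills on the three-torus at fixed lattice data — a RUNG: NOT d = 4, NOT infinite volume, NOT a mass gap,
NOT Clay).  Width seat `ym3-torus-px13` (gen 27); crux `stmt-QuantumFields-20520`, LINE g18-1 S2β, pairing lane; (SCT″-c)₁ source budget (S-SRC), px13 g27 holder; sibling of px16 g23's
torus knit ✓`…CurlKernelKnitTorus.weighted_readMax_sq_le` (p831858; its second summand carried the sources by `Σ_j (L²)^{n−j}·τ`).  THIS FILE: on ONE torus `T^{(·)}` of a generic `P`, with
(M-3)'s read cells (`ends`, `θ`, `η`), weights `Λ n ≥ 0` and per-source-level FLATNESS constants `Λs j` (`Λ n·(m_P^{n−j}∕(L^d)^j)²·(L^d)^n ≤ Λs j`; at `d = 3`, `Λ n = L^{m−1−n}`: `Λs j = L^{m−1−4j}`),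
positive level weights `w j` with `Σ_{j ∈ Icc 1 n} w_j⁻¹ ≤ W` (geometric ⇒ `W` N-free):
  `Σ_{n≤m} Λ n·Σ_i ρ n (sel n i)² ≤ 2·Λs 0·κ²ν·C_b·Σ_z ρ 0 z² + 2·W·Σ_{j∈Icc 1 m} w j·Λs j·κ²ν·C_b·(L^d)^j·Σ_c src j c²`
(`κ = 5^d`, `ν = (2(θ+2)+1)^d·η`, `C_b = 2(L^d−1)∕(L^d−3)`) — PROOF: ✓`exists_composedKernelFamily` per target level ((K5′) exact propagation), the square split + ✓`sq_sum_le_inv_weights_mul`,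
then ✓`dock_of_levelData` once for the data (`j = 0`) and once per source level.  `--kind proof --supports stmt-QuantumFields-20520 --as helper`, count-neutral, DEFINITION-FREE.

WHAT IS PROVED (sorry-free).  ★★★`weighted_readMax_sq_le_sources` (the display above).  What (S-SRC) still owes after it: the source ENERGIES `Σ_c src j c²` priced by (BKG) (linear
part) and (RSP) × energy (quadratic part, ✓`…SourceEnergy`), and the choice of `Λ`, `Λs`, `w` in S-KER's currency.

HONEST.  Finite-sum algebra over landed∕signed letters; nothing of Bałaban's asserted; (BKG), (RSP), the gauge energy letter, (ST″), (SCT″-c)₁₂₃, LOC, GAP♯∘ (`stub_uniformFibreGapOrbit`, registry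
3732b7df UNTOUCHED, 0∕5), the five REGISTERED stubs, S2β, crux 20520, 19936, 19200, `YM3TorusSU2` — NOT proved; rung R3 = SU(2) YM₃ on T³ — NOT d = 4, NOT infinite volume, NOT a mass gap,
NOT Clay; the Yang–Mills mass gap is NOT proved.  Axioms standard.

References: [Balaban1985Averaging] CMP **98** (1985) (19)–(20) p.21, Prop. 1 (51) p.26, Prop. 4 (128)–(135) pp.37–38; [Balaban1987RG1] CMP **109** (1987) (0.1)–(0.4), (0.11) pp.251–253.
-/

set_option autoImplicit false

noncomputable section

open Finset

namespace Summit.QuantumFields.YangMills.Theorems.FluctuationComparisonRegPrIntLS2BetaSourceBudgetCore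

open Literature.MathematicalPhysics.QuantumFieldTheory.Balaban1983to89
open Literature.MathematicalPhysics.QuantumFieldTheory.Balaban1983to89.T4Continuum
open Literature.MathematicalPhysics.QuantumFieldTheory.Balaban1983to89.BlockAveraging (Idx)
open Literature.MathematicalPhysics.QuantumFieldTheory.Balaban1983to89.B10Eq47AxialChi (shiftN)
open Literature.MathematicalPhysics.QuantumFieldTheory.Balaban1983to89.B14.Eq22Determines (blockIter)
open Literature.MathematicalPhysics.QuantumFieldTheory.Balaban1983to89.B10Eq27TorusAxialLog (rel)
open Summit.QuantumFields.YangMills.Theorems.FluctuationComparisonRegPrIntLS2BetaComposedDilutionKernelSourceFamily (exists_composedKernelFamily)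
open Summit.QuantumFields.YangMills.Theorems.FluctuationComparisonRegPrIntLS2BetaSourceDock (sq_sum_le_inv_weights_mul dock_of_levelData)

variable {P : Params}

/-- ★★★ **THE SOURCE BUDGET CORE** — see the module header. [cite: Balaban1985Averaging, Prop. 4 (128)-(135) pp.37-38; Balaban1987RG1, (0.11) p.253] -/
theorem weighted_readMax_sq_le_sources (hb : 4 ≤ P.L ^ P.d) {μ ν : Fin P.d} (hμν : μ ≠ ν) {m : ℕ} (hm : m ≤ P.m + P.K)
    {ι : Type*} [Fintype ι] (ends : ι → Finset (Site P m)) (θ η : ℕ)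
    (hends : ∀ e : Site P m, (univ.filter (fun i : ι => e ∈ ends i)).card ≤ η)
    (ρ src : (i : ℕ) → Site P i → ℝ) (hρ : ∀ i x, 0 ≤ ρ i x) (hsrc : ∀ i x, 0 ≤ src i x)
    (hrow : ∀ i, i < m → ∀ y' : Site P (i + 1),
        ρ (i + 1) y' ≤ (Fintype.card (Idx P) : ℝ)⁻¹ *
            ∑ a ∈ (Finset.univ : Finset (Idx P)) ×ˢ (Finset.range P.L ×ˢ Finset.range P.L), ρ i (shiftN (shiftN (Site.blockSite y' a.1.1) μ a.2.1) ν a.2.2) +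
          src (i + 1) y')
    (Λ : ℕ → ℝ) (hΛ : ∀ n, 0 ≤ Λ n) (Λs : ℕ → ℝ)
    (hflat : ∀ j, j ≤ m → ∀ n, n ≤ m →
      Λ n * (((((Fintype.card (Equiv.Perm (Fin P.d))) ^ 2 * P.L ^ 2 : ℕ) : ℝ) / (Fintype.card (Idx P) : ℝ)) ^ (n - j) / ((P.L ^ P.d : ℕ) : ℝ) ^ j) ^ 2 *
        ((P.L ^ P.d : ℕ) : ℝ) ^ n ≤ Λs j)
    (w : ℕ → ℝ) (hw : ∀ j, 0 < w j) (W : ℝ) (hW : ∀ n, n ≤ m → ∑ j ∈ Finset.Icc 1 n, (w j)⁻¹ ≤ W)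
    (sel : (n : ℕ) → ι → Site P n)
    (hsel : ∀ n, n ≤ m → ∀ i, ∃ z : Site P 0, blockIter m z ∈ ends i ∧ ∀ κ, (rel (blockIter n z) (sel n i) κ).natAbs ≤ θ) :
    ∑ n ∈ Finset.range (m + 1), Λ n * ∑ i, ρ n (sel n i) ^ 2 ≤
      2 * (Λs 0 * ((5 ^ P.d : ℕ) : ℝ) ^ 2 * (((2 * (θ + 2) + 1) ^ P.d * η : ℕ) : ℝ) * (2 * (((P.L ^ P.d : ℕ) : ℝ) - 1) / (((P.L ^ P.d : ℕ) : ℝ) - 3)) *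
          (((P.L ^ P.d : ℕ) : ℝ) ^ 0 * ∑ z, ρ 0 z ^ 2)) +
        2 * W * ∑ j ∈ Finset.Icc 1 m, w j *
          (Λs j * ((5 ^ P.d : ℕ) : ℝ) ^ 2 * (((2 * (θ + 2) + 1) ^ P.d * η : ℕ) : ℝ) * (2 * (((P.L ^ P.d : ℕ) : ℝ) - 1) / (((P.L ^ P.d : ℕ) : ℝ) - 3)) *
            (((P.L ^ P.d : ℕ) : ℝ) ^ j * ∑ c, src j c ^ 2)) := by
  classical
  set mP : ℝ := ((((Fintype.card (Equiv.Perm (Fin P.d))) ^ 2 * P.L ^ 2 : ℕ) : ℝ) / (Fintype.card (Idx P) : ℝ)) with hmP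
  have hmP0 : 0 ≤ mP := by rw [hmP]; positivity
  -- STEP 0: the kernel families per target level, padded by zero outside `j ≤ n ≤ m+K`
  have hex := fun (n : ℕ) (hn : n ≤ P.m + P.K) => exists_composedKernelFamily (P := P) hμν n hn
  choose Kf hK0 hK1 hK2 hK3 hK4 hK5 using hex
  set Kg : (n : ℕ) → (j : ℕ) → Site P n → Site P j → ℝ :=
    fun n j y c => if h : j ≤ n ∧ n ≤ P.m + P.K then Kf n h.2 j y c else 0 with hKg
  have hKg_of : ∀ {n j : ℕ} (hjn : j ≤ n) (hn : n ≤ P.m + P.K) (y : Site P n) (c : Site P j), Kg n j y c = Kf n hn j y c := by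
    intro n j hjn hn y c; simp only [hKg, dif_pos (And.intro hjn hn)]
  have hKg0 : ∀ n j (y : Site P n) (c : Site P j), 0 ≤ Kg n j y c := by
    intro n j y c
    by_cases h : j ≤ n ∧ n ≤ P.m + P.K
    · rw [hKg_of h.1 h.2]; exact hK0 n h.2 j h.1 y c
    · simp only [hKg, dif_neg h]; exact le_rfl
  have hKg1 : ∀ n j (y : Site P n) (c : Site P j), Kg n j y c ≤ mP ^ (n - j) := by
    intro n j y c
    by_cases h : j ≤ n ∧ n ≤ P.m + P.K
    · rw [hKg_of h.1 h.2]; exact hK1 n h.2 j h.1 y c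
    · simp only [hKg, dif_neg h]; exact pow_nonneg hmP0 _
  have hKg4 : ∀ n j (y : Site P n) (q : Site P 0), Kg n j y (blockIter j q) ≠ 0 → ∀ κ, (rel y (blockIter n q) κ).natAbs ≤ 2 := by
    intro n j y q hne κ
    by_cases h : j ≤ n ∧ n ≤ P.m + P.K
    · rw [hKg_of h.1 h.2] at hne; exact hK4 n h.2 j h.1 y q hne κ
    · exact absurd (by simp only [hKg, dif_neg h]) hne
  -- abbreviations for the propagated pieces
  set P0 : ℕ → ι → ℝ := fun n i => ∑ z, Kg n 0 (sel n i) z * ρ 0 z with hP0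
  set Ps : ℕ → ℕ → ι → ℝ := fun j n i => ∑ c, Kg n j (sel n i) c * src j c with hPs
  have hPs0 : ∀ j n i, 0 ≤ Ps j n i := fun j n i => sum_nonneg fun c _ => mul_nonneg (hKg0 n j _ c) (hsrc j c)
  -- STEP 1: exact propagation at every read cell
  have hprop : ∀ n ∈ Finset.range (m + 1), ∀ i, ρ n (sel n i) ≤ P0 n i + ∑ j ∈ Finset.Icc 1 n, Ps j n i := by
    intro n hn i
    rw [Finset.mem_range] at hn
    have hnm : n ≤ m := by omega
    have hnP : n ≤ P.m + P.K := hnm.trans hm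
    have h := hK5 n hnP ρ src (fun i hi y' => hrow i (by omega) y') (sel n i)
    have e0 : ∑ z, Kf n hnP 0 (sel n i) z * ρ 0 z = P0 n i :=
      Finset.sum_congr rfl fun z _ => by rw [hKg_of (Nat.zero_le n) hnP]
    have es : ∑ j ∈ Finset.Icc 1 n, ∑ c, Kf n hnP j (sel n i) c * src j c = ∑ j ∈ Finset.Icc 1 n, Ps j n i :=
      Finset.sum_congr rfl fun j hj => Finset.sum_congr rfl fun c _ => by
        rw [Finset.mem_Icc] at hj; rw [hKg_of hj.2 hnP]
    rw [e0, es] at h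
    exact h
  -- STEP 2: square and split with the level weights
  have hsq : ∀ n ∈ Finset.range (m + 1), ∀ i, ρ n (sel n i) ^ 2 ≤ 2 * P0 n i ^ 2 + 2 * W * ∑ j ∈ Finset.Icc 1 m, w j * Ps j n i ^ 2 := by
    intro n hn i
    have hnm : n ≤ m := by rw [Finset.mem_range] at hn; omega
    have h1 := hprop n hn i
    have hρ0 := hρ n (sel n i)
    have h2 : ρ n (sel n i) ^ 2 ≤ 2 * P0 n i ^ 2 + 2 * (∑ j ∈ Finset.Icc 1 n, Ps j n i) ^ 2 := by
      have := pow_le_pow_left₀ hρ0 h1 2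
      nlinarith [sq_nonneg (P0 n i - ∑ j ∈ Finset.Icc 1 n, Ps j n i)]
    have h3 : (∑ j ∈ Finset.Icc 1 n, Ps j n i) ^ 2 ≤ W * ∑ j ∈ Finset.Icc 1 m, w j * Ps j n i ^ 2 := by
      have hcs := sq_sum_le_inv_weights_mul (Finset.Icc 1 n) (fun j => Ps j n i) w (fun j _ => hw j)
      have hsub : ∑ j ∈ Finset.Icc 1 n, w j * Ps j n i ^ 2 ≤ ∑ j ∈ Finset.Icc 1 m, w j * Ps j n i ^ 2 :=
        Finset.sum_le_sum_of_subset_of_nonneg (Finset.Icc_subset_Icc_right hnm) fun j _ _ => mul_nonneg (hw j).le (sq_nonneg _)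
      have hnn : 0 ≤ ∑ j ∈ Finset.Icc 1 n, w j * Ps j n i ^ 2 := Finset.sum_nonneg fun j _ => mul_nonneg (hw j).le (sq_nonneg _)
      have hWn := hW n hnm
      have hW0 : 0 ≤ W := (Finset.sum_nonneg fun j _ => (inv_pos.mpr (hw j)).le).trans hWn
      calc (∑ j ∈ Finset.Icc 1 n, Ps j n i) ^ 2 ≤ (∑ j ∈ Finset.Icc 1 n, (w j)⁻¹) * ∑ j ∈ Finset.Icc 1 n, w j * Ps j n i ^ 2 := hcs
        _ ≤ W * ∑ j ∈ Finset.Icc 1 n, w j * Ps j n i ^ 2 := mul_le_mul_of_nonneg_right hWn hnn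
        _ ≤ W * ∑ j ∈ Finset.Icc 1 m, w j * Ps j n i ^ 2 := mul_le_mul_of_nonneg_left hsub hW0
    linarith
  -- STEP 3: sum with the generation weights and swap
  have hsum : ∑ n ∈ Finset.range (m + 1), Λ n * ∑ i, ρ n (sel n i) ^ 2 ≤
      2 * (∑ n ∈ Finset.range (m + 1), Λ n * ∑ i, P0 n i ^ 2) +
        2 * W * ∑ j ∈ Finset.Icc 1 m, w j * (∑ n ∈ Finset.range (m + 1), Λ n * ∑ i, Ps j n i ^ 2) := by
    have step : ∀ n ∈ Finset.range (m + 1), Λ n * ∑ i, ρ n (sel n i) ^ 2 ≤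
        Λ n * ∑ i, (2 * P0 n i ^ 2 + 2 * W * ∑ j ∈ Finset.Icc 1 m, w j * Ps j n i ^ 2) :=
      fun n hn => mul_le_mul_of_nonneg_left (Finset.sum_le_sum fun i _ => hsq n hn i) (hΛ n)
    refine (Finset.sum_le_sum step).trans (le_of_eq ?_)
    have e : ∀ n ∈ Finset.range (m + 1), Λ n * ∑ i, (2 * P0 n i ^ 2 + 2 * W * ∑ j ∈ Finset.Icc 1 m, w j * Ps j n i ^ 2) =
        2 * (Λ n * ∑ i, P0 n i ^ 2) + 2 * W * ∑ j ∈ Finset.Icc 1 m, w j * (Λ n * ∑ i, Ps j n i ^ 2) := by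
      intro n _
      have e1 : ∑ i, (2 * P0 n i ^ 2 + 2 * W * ∑ j ∈ Finset.Icc 1 m, w j * Ps j n i ^ 2) =
          2 * ∑ i, P0 n i ^ 2 + 2 * W * ∑ j ∈ Finset.Icc 1 m, w j * ∑ i, Ps j n i ^ 2 := by
        rw [Finset.sum_add_distrib, ← Finset.mul_sum, ← Finset.mul_sum, Finset.sum_comm]
        congr 1
        congr 1
        exact Finset.sum_congr rfl fun j _ => by rw [Finset.mul_sum]
      have e2 : Λ n * (2 * W * ∑ j ∈ Finset.Icc 1 m, w j * ∑ i, Ps j n i ^ 2) =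
          2 * W * ∑ j ∈ Finset.Icc 1 m, w j * (Λ n * ∑ i, Ps j n i ^ 2) := by
        rw [show Λ n * (2 * W * ∑ j ∈ Finset.Icc 1 m, w j * ∑ i, Ps j n i ^ 2) =
            2 * W * (Λ n * ∑ j ∈ Finset.Icc 1 m, w j * ∑ i, Ps j n i ^ 2) by ring, Finset.mul_sum]
        congr 1
        exact Finset.sum_congr rfl fun j _ => by ring
      rw [e1, mul_add, e2]
      ring
    rw [Finset.sum_congr rfl e, Finset.sum_add_distrib, ← Finset.mul_sum, ← Finset.mul_sum, Finset.sum_comm]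
    congr 1
    congr 1
    refine Finset.sum_congr rfl fun j _ => ?_
    rw [Finset.mul_sum]
  -- STEP 4: dock the data and each source level
  have hdock0 := dock_of_levelData hb hm (Nat.zero_le m) ends θ η hends (ρ 0) (hρ 0) (fun n => Kg n 0) (fun n => mP ^ (n - 0))
    (fun n => pow_nonneg hmP0 _) (fun n Y c => hKg0 n 0 Y c) (fun n Y c => hKg1 n 0 Y c) (fun n Y q h => hKg4 n 0 Y q h)
    Λ (Λs 0) hΛ (fun n hn => by simpa only [hmP] using hflat 0 (Nat.zero_le m) n hn) sel hsel
  have hdockj : ∀ j ∈ Finset.Icc 1 m, ∑ n ∈ Finset.range (m + 1), Λ n * ∑ i, Ps j n i ^ 2 ≤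
      Λs j * ((5 ^ P.d : ℕ) : ℝ) ^ 2 * (((2 * (θ + 2) + 1) ^ P.d * η : ℕ) : ℝ) * (2 * (((P.L ^ P.d : ℕ) : ℝ) - 1) / (((P.L ^ P.d : ℕ) : ℝ) - 3)) *
        (((P.L ^ P.d : ℕ) : ℝ) ^ j * ∑ c, src j c ^ 2) := by
    intro j hj
    rw [Finset.mem_Icc] at hj
    exact dock_of_levelData hb hm hj.2 ends θ η hends (src j) (hsrc j) (fun n => Kg n j) (fun n => mP ^ (n - j))
      (fun n => pow_nonneg hmP0 _) (fun n Y c => hKg0 n j Y c) (fun n Y c => hKg1 n j Y c) (fun n Y q h => hKg4 n j Y q h)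
      Λ (Λs j) hΛ (fun n hn => by simpa only [hmP] using hflat j hj.2 n hn) sel hsel
  -- STEP 5: assemble
  have hW0 : 0 ≤ W := (Finset.sum_nonneg fun j _ => (inv_pos.mpr (hw j)).le).trans (hW 0 (Nat.zero_le m))
  have hsrcsum : ∑ j ∈ Finset.Icc 1 m, w j * (∑ n ∈ Finset.range (m + 1), Λ n * ∑ i, Ps j n i ^ 2) ≤
      ∑ j ∈ Finset.Icc 1 m, w j *
        (Λs j * ((5 ^ P.d : ℕ) : ℝ) ^ 2 * (((2 * (θ + 2) + 1) ^ P.d * η : ℕ) : ℝ) * (2 * (((P.L ^ P.d : ℕ) : ℝ) - 1) / (((P.L ^ P.d : ℕ) : ℝ) - 3)) *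
          (((P.L ^ P.d : ℕ) : ℝ) ^ j * ∑ c, src j c ^ 2)) :=
    Finset.sum_le_sum fun j hj => mul_le_mul_of_nonneg_left (hdockj j hj) (hw j).le
  calc ∑ n ∈ Finset.range (m + 1), Λ n * ∑ i, ρ n (sel n i) ^ 2
      ≤ 2 * (∑ n ∈ Finset.range (m + 1), Λ n * ∑ i, P0 n i ^ 2) +
          2 * W * ∑ j ∈ Finset.Icc 1 m, w j * (∑ n ∈ Finset.range (m + 1), Λ n * ∑ i, Ps j n i ^ 2) := hsum
    _ ≤ _ := add_le_add (mul_le_mul_of_nonneg_left hdock0 (by norm_num)) (mul_le_mul_of_nonneg_left hsrcsum (by positivity))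

end Summit.QuantumFields.YangMills.Theorems.FluctuationComparisonRegPrIntLS2BetaSourceBudgetCore

end
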